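import Mathlib
import Summits.ResolutionOfSingularities.ResolutionOfSingularities.Theorems.HomologicalConductorPersistenceCyclicQuotientSurface
import HarnessLib

/-!
# Rung S-2 `PersistenceSurface` (stmt-19970) — the cyclic quotient surface `k[u,v]^{μ_n(1,q)}`, II: NOETHER'S
# FINITENESS discharged (`U` noetherian, `k[u,v]` module-finite over `U`), so the engines' criterion is a kernel
# theorem with NO instance hypotheses (chain W4.4b, seat res-L1-w44b-stub-4 gen 5; T-V part 14)

[OURS · L1 w44b · rung S-2] Nothing here is a statement of the manuscript under review (Hironaka 2017);
AI-written, weaker than expert review.  Completes part 13 (`…PersistenceCyclicQuotientSurface`, p547988): the two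
instance hypotheses `[IsNoetherianRing U]`, `[Module.Finite U k[u,v]]` of AUSLANDER'S LAW for `1/n(1,q)` are PROVED.

* `isNoetherianRing_of_retract` — a subring `U → V` of a noetherian ring admitting a `U`-linear retraction
  `ρ : V → U` is noetherian (every ideal `I` is generated by the `I`-coefficients of generators of `IV`:
  `I = ρ(IV)`; folklore — the Reynolds-operator proof of Hilbert's finiteness theorem).
* `moduleFinite_cyclicQuotient` — `k[u,v] = Σ_{i,j<n} U · uⁱvʲ` (`uⁿ, vⁿ ∈ U`).
* `isNoetherianRing_cyclicQuotient` — via the Reynolds operator of part 10 (`exists_reynolds_group`).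
* **`mem_cohomologyAnnihilatorOfDegree_three_iff_cyclicQuotient'`**, **`monomial_mem_cohomologyAnnihilatorOfDegree_three'`**
  — part 13's law and criterion with the instance hypotheses removed: for `ζ` a primitive `n`-th root of unity in
  `k`, `n ∈ kˣ`, `gcd(q,n) = 1`, `U = k[u,v]^{σ₀}`: an invariant monomial `uⁱvʲ` whose divisors realise every residue
  `mod n` lies in `ca³(U) ⊆ ca(U)`; and `x ∈ ca³(U) ⟺ x ∈ ⋂_a V_[a]·V_[−a]`.

References: Iyengar–Takahashi, IMRN 2016, arXiv:1404.1476 [`IyengarTakahashi2014`]; M. Auslander, Trans. AMS 293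
(1986); D. Hilbert / E. Noether (finiteness of invariants via the Reynolds operator), folklore.
-/

-- single-problem summit: the doubled namespace component `ResolutionOfSingularities` is forced
set_option linter.dupNamespace false

noncomputable section

open CategoryTheory Literature.RingTheory.CohomologyAnnihilator MvPolynomial
open Summit.ResolutionOfSingularities.ResolutionOfSingularities.Theorems.HomologicalConductor.PersistenceCyclicTransferAbelianCoinduced
open Summit.ResolutionOfSingularities.ResolutionOfSingularities.Theorems.HomologicalConductor.PersistenceCyclicQuotientSurface

universe u

namespace Summit.ResolutionOfSingularities.ResolutionOfSingularities.Theorems.HomologicalConductor.PersistenceCyclicQuotientSurfaceFinite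

/-! ## Retracts of noetherian rings are noetherian -/

/-- **A retract of a noetherian ring is noetherian.**  `algebraMap U V` injective, `V` noetherian, `ρ : V → U`
`U`-linear with `ρ ∘ algebraMap = id` ⟹ `U` noetherian: for an ideal `I ⊆ U`, pick generators of `IV`, collect their
(finitely many) `I`-coefficients into `I₀ ⊆ I`; then `x = ρ(x) ∈ ρ(I₀V) ⊆ I₀` for every `x ∈ I`. [folklore] -/
theorem isNoetherianRing_of_retract {U V : Type u} [CommRing U] [CommRing V] [Algebra U V] [IsNoetherianRing V]
    (ρ : V →ₗ[U] U) (hρ : ∀ u, ρ (algebraMap U V u) = u) : IsNoetherianRing U := by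
  classical
  -- `ρ` maps `I₀·V` back into `I₀`
  have hret : ∀ (I₀ : Ideal U) (y : V), y ∈ I₀.map (algebraMap U V) → ∀ v : V, ρ (v * y) ∈ I₀ := by
    intro I₀ y hy
    refine Submodule.span_induction (p := fun y _ => ∀ v : V, ρ (v * y) ∈ I₀) ?_ ?_ ?_ ?_ hy
    · rintro _ ⟨a, ha, rfl⟩ v
      rw [mul_comm, ← Algebra.smul_def, map_smul, smul_eq_mul]
      exact I₀.mul_mem_right _ ha
    · intro v; rw [mul_zero, map_zero]; exact I₀.zero_mem
    · intro y z _ _ hy hz v; rw [mul_add, map_add]; exact I₀.add_mem (hy v) (hz v)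
    · intro w y _ hy v; rw [smul_eq_mul, ← mul_assoc]; exact hy (v * w)
  refine isNoetherianRing_iff_ideal_fg U |>.mpr fun I => ?_
  -- generators of `I·V` and their `I`-coefficients
  have hfg : (I.map (algebraMap U V)).FG := (isNoetherianRing_iff_ideal_fg V).mp inferInstance _
  obtain ⟨G, hG⟩ := hfg
  have hgen : ∀ g ∈ G, ∃ (s : Finset U) (_ : ∀ a ∈ s, a ∈ I),
      (g : V) ∈ (Ideal.span (s : Set U)).map (algebraMap U V) := by
    intro g hg
    have hgI : g ∈ I.map (algebraMap U V) := hG ▸ Ideal.subset_span hg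
    rw [Ideal.map] at hgI
    -- finite support inside the image of `I`
    obtain ⟨T, hT, hgT⟩ := Submodule.mem_span_finite_of_mem_span hgI
    have hT' : ∀ t ∈ T, ∃ a ∈ I, algebraMap U V a = t := fun t ht => by
      obtain ⟨a, ha, hav⟩ := hT ht
      exact ⟨a, ha, hav⟩
    choose a ha hav using hT'
    refine ⟨T.attach.image (fun t => a t.1 t.2), fun b hb => ?_, ?_⟩
    · obtain ⟨t, _, rfl⟩ := Finset.mem_image.mp hb; exact ha _ _
    · refine Submodule.span_mono ?_ hgT
      intro t ht
      refine ⟨a t ht, Ideal.subset_span ?_, hav t ht⟩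
      exact Finset.mem_image.mpr ⟨⟨t, ht⟩, Finset.mem_attach _ _, rfl⟩
  choose s hsI hs using hgen
  let S : Finset U := G.attach.biUnion fun g => s g.1 g.2
  have hSI : Ideal.span (S : Set U) ≤ I := Ideal.span_le.mpr fun b hb => by
    obtain ⟨g, _, hb'⟩ := Finset.mem_biUnion.mp hb
    exact hsI _ _ b hb'
  refine ⟨S, le_antisymm hSI fun x hx => ?_⟩
  -- `x ∈ I` ⇒ `algebraMap x ∈ I·V = Σ V g ⊆ (span S)·V` ⇒ `x = ρ(algebraMap x) ∈ span S`
  have hxV : algebraMap U V x ∈ (Ideal.span (S : Set U)).map (algebraMap U V) := by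
    have h1 : algebraMap U V x ∈ I.map (algebraMap U V) := Ideal.mem_map_of_mem _ hx
    rw [← hG] at h1
    refine (Ideal.span_le.mpr fun g hg => ?_) h1
    have := hs g hg
    exact Ideal.map_mono (Ideal.span_mono (fun b hb => Finset.mem_biUnion.mpr ⟨⟨g, hg⟩, Finset.mem_attach _ _, hb⟩)) this
  have := hret _ _ hxV 1
  rwa [one_mul, hρ] at this

/-! ## `k[u,v]` is module-finite over the invariants, and the invariants are noetherian -/

section Finite

variable {k : Type u} [Field k] {n : ℕ} [NeZero n] {ζ : k} (hζ : IsPrimitiveRoot ζ n) (hn : (n : k) ≠ 0) (q : ℕ)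
variable (U : Subalgebra k (MvPolynomial (Fin 2) k))
variable (hU : ∀ p, p ∈ U ↔ aeval (fun i : Fin 2 => C (ζ ^ (![1, q] : Fin 2 → ℕ) i) * X i) p = p)

omit [NeZero n] in
include hζ hU in
/-- `uⁿ`, `vⁿ`, constants, and their products lie in `U`; precisely: a monomial all of whose exponents are multiples of
`n` is invariant. [OURS · L1 w44b] -/
theorem monomial_mul_mem (d : Fin 2 →₀ ℕ) (c : k) (h0 : n ∣ d 0) (h1 : n ∣ d 1) : monomial d c ∈ U := by
  rw [hU, rootAut_monomial, (hζ.pow_eq_one_iff_dvd _).mpr (dvd_add h0 (dvd_mul_of_dvd_right h1 _)), C_1, one_mul]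

include hζ hU in
/-- **`k[u,v]` is a finitely generated `U`-module**, generated by the `n²` monomials `uⁱvʲ`, `i, j < n`.
[folklore] -/
theorem moduleFinite_cyclicQuotient : Module.Finite U (MvPolynomial (Fin 2) k) := by
  classical
  let S : Finset (MvPolynomial (Fin 2) k) :=
    (Finset.range n ×ˢ Finset.range n).image fun ij => X 0 ^ ij.1 * X 1 ^ ij.2
  refine ⟨⟨S, ?_⟩⟩
  rw [eq_top_iff]
  rintro p -
  rw [p.as_sum]
  refine Submodule.sum_mem _ fun d _ => ?_
  -- `monomial d c = (c · u^{n⌊d₀/n⌋} v^{n⌊d₁/n⌋}) • (u^{d₀ mod n} v^{d₁ mod n})`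
  have hnpos : 0 < n := Nat.pos_of_ne_zero (NeZero.ne n)
  let e : Fin 2 →₀ ℕ := Finsupp.single 0 (n * (d 0 / n)) + Finsupp.single 1 (n * (d 1 / n))
  have heU : monomial e (p.coeff d) ∈ U :=
    monomial_mul_mem hζ q U hU e _ (by simp [e]) (by simp [e])
  have hexp : e + (Finsupp.single 0 (d 0 % n) + Finsupp.single 1 (d 1 % n)) = d := by
    ext i; fin_cases i <;> simp [e, Nat.div_add_mod]
  have hdecomp : monomial d (p.coeff d) =
      (⟨monomial e (p.coeff d), heU⟩ : U) • (X 0 ^ (d 0 % n) * X 1 ^ (d 1 % n) : MvPolynomial (Fin 2) k) := by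
    change _ = monomial e (p.coeff d) * _
    rw [X_pow_eq_monomial, X_pow_eq_monomial, monomial_mul, monomial_mul, mul_one, mul_one, hexp]
  rw [hdecomp]
  refine Submodule.smul_mem _ _ (Submodule.subset_span ?_)
  refine Finset.mem_coe.mpr (Finset.mem_image.mpr ⟨(d 0 % n, d 1 % n), ?_, rfl⟩)
  simp [Nat.mod_lt _ hnpos]

include hζ hn hU in
/-- **The invariant ring `U = k[u,v]^{μ_n}` is noetherian** (Reynolds retract of the noetherian ring `k[u,v]`).
[folklore] -/
theorem isNoetherianRing_cyclicQuotient : IsNoetherianRing U := by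
  obtain ⟨σ, -, hfix⟩ := exists_action hζ q U hU
  have hinj : Function.Injective (algebraMap U (MvPolynomial (Fin 2) k)) := Subtype.val_injective
  have hGU : IsUnit ((Fintype.card (Multiplicative (ZMod n)) : ℕ) : U) := by
    rw [Fintype.card_multiplicative, ZMod.card]
    have : ((n : ℕ) : U) = algebraMap k U n := by rw [map_natCast]
    rw [this]
    exact (IsUnit.mk0 _ hn).map _
  obtain ⟨ρ, hρalg, -, -⟩ := exists_reynolds_group σ hfix hinj hGU
  exact isNoetherianRing_of_retract ρ hρalg

end Finite

/-! ## The law and the criterion without instance hypotheses -/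

section Law

variable {k : Type u} [Field k] {n : ℕ} [NeZero n] {ζ : k} (hζ : IsPrimitiveRoot ζ n) (hn : (n : k) ≠ 0)
variable {q : ℕ} (hq : q.Coprime n) (U : Subalgebra k (MvPolynomial (Fin 2) k))
variable (hU : ∀ p, p ∈ U ↔ aeval (fun i : Fin 2 => C (ζ ^ (![1, q] : Fin 2 → ℕ) i) * X i) p = p)

include hζ hn hq hU in
/-- **AUSLANDER'S LAW for `1/n(1,q)`, hypothesis-free form.**  `x ∈ ca³(k[u,v]^{μ_n(1,q)})` iff for every residue
`a`, `x = Σ_k b_k b′_k` with `σ₀ b_k = ζ^a b_k`, `σ₀ b′_k = ζ^{−a} b′_k`. [OURS · L1 w44b] -/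
theorem mem_cohomologyAnnihilatorOfDegree_three_iff_cyclicQuotient' (x : U) :
    x ∈ cohomologyAnnihilatorOfDegree U 3 ↔
      ∀ a : ZMod n, ∃ (m : ℕ) (b b' : Fin m → MvPolynomial (Fin 2) k),
        (∀ j, aeval (fun i : Fin 2 => C (ζ ^ (![1, q] : Fin 2 → ℕ) i) * X i) (b j) = C (ζ ^ a.val) * b j) ∧
        (∀ j, aeval (fun i : Fin 2 => C (ζ ^ (![1, q] : Fin 2 → ℕ) i) * X i) (b' j) = C (ζ ^ (-a).val) * b' j) ∧
        ∑ j, b j * b' j = (x : MvPolynomial (Fin 2) k) := by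
  haveI := isNoetherianRing_cyclicQuotient hζ hn q U hU
  haveI := moduleFinite_cyclicQuotient hζ q U hU
  exact mem_cohomologyAnnihilatorOfDegree_three_iff_cyclicQuotient hζ hn hq U hU x

include hζ hn hq hU in
/-- **The engines' criterion at a cyclic arrival, hypothesis-free**: an invariant monomial `uⁱvʲ` with divisors of
every weight mod `n` lies in `ca³(k[u,v]^{μ_n(1,q)})`. [OURS · L1 w44b] -/
theorem monomial_mem_cohomologyAnnihilatorOfDegree_three' (i j : ℕ)
    (hmem : (X 0 ^ i * X 1 ^ j : MvPolynomial (Fin 2) k) ∈ U)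
    (hdiv : ∀ a : ZMod n, ∃ i₁ j₁ : ℕ, i₁ ≤ i ∧ j₁ ≤ j ∧ ((i₁ + q * j₁ : ℕ) : ZMod n) = a) :
    (⟨X 0 ^ i * X 1 ^ j, hmem⟩ : U) ∈ cohomologyAnnihilatorOfDegree U 3 := by
  haveI := isNoetherianRing_cyclicQuotient hζ hn q U hU
  haveI := moduleFinite_cyclicQuotient hζ q U hU
  exact monomial_mem_cohomologyAnnihilatorOfDegree_three hζ hn hq U hU i j hmem hdiv

include hζ hn hq hU in
/-- The same in `ca` (the route's `ca = ⋃ₙ caⁿ`). [OURS · L1 w44b] -/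
theorem monomial_mem_cohomologyAnnihilator (i j : ℕ) (hmem : (X 0 ^ i * X 1 ^ j : MvPolynomial (Fin 2) k) ∈ U)
    (hdiv : ∀ a : ZMod n, ∃ i₁ j₁ : ℕ, i₁ ≤ i ∧ j₁ ≤ j ∧ ((i₁ + q * j₁ : ℕ) : ZMod n) = a) :
    (⟨X 0 ^ i * X 1 ^ j, hmem⟩ : U) ∈ cohomologyAnnihilator U :=
  cohomologyAnnihilatorOfDegree_le (R := U) 3 (monomial_mem_cohomologyAnnihilatorOfDegree_three' hζ hn hq U hU i j hmem hdiv)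

end Law

end Summit.ResolutionOfSingularities.ResolutionOfSingularities.Theorems.HomologicalConductor.PersistenceCyclicQuotientSurfaceFinite

end
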